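import Summits.CriticalPhenomena.CardyFormulaZ2.Theorems.CardyIKTransportIKLinearTransportScreeningArray3

/-!
# Screening estimates for a finite array of independent biased bits, part 4: `screeningArray`

Support file (`--supports stmt-CriticalPhenomena-5076`, registered sub-goal `screeningArray`) for the stub
`stub_Screening` of the line `pinned-diagram-exchange` (crux `IKLinearTransport`); continues parts 1 and 3.
* `sum_nontrivial_le`: THE SCREENING SUM `Σ_{(C,R) ∉ {(∅,∅),(all,all)}} θ^{#(X(C,R) ∖ UR)} ≤ Σ* = sigmaStar m k n θ`
  by the case analysis on the low parts `C ∩ {c < n}`, `R ∩ {r < n}`: rows mixed → `≥ m` unread entries;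
  columns mixed → `≥ k`; both low parts `≡ v` → `≥ n (#{C = ¬v} + #{R = ¬v})`, generating sum
  `(1 + θ^n)^{m+k-2n} - 1` for each `v`; low parts constant and different → `≥ n²`.
* `epsCR_top_eq_one`: consistency `Σ_c kk.1 c ≡ Σ_r kk.2 r` whenever some array has parities `kk`.
* `screeningArray`: `E[F; kk] = 2^{-(m+k)} (2 E[F] + e_F)`, `P(kk) = 2^{-(m+k)} (2 + e_1)`, `|e_F|, |e_1| ≤ Σ* ≤ 1`,
  whence `|E[F; kk] - E[F] P(kk)| ≤ 2^{-(m+k)} · 2 Σ* ≤ 2 Σ* P(kk)`.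
-/

namespace Summit.CriticalPhenomena.CardyFormulaZ2.Theorems.IKLinearTransport.PinnedDiagramExchange.ScreeningArray

open Finset

variable {m k : ℕ}

/-! ## The screening sum and the conclusion -/

/-- A side that is not constant on its low part takes both values there. -/
theorem exists_low_eq_not {l : ℕ} (n : ℕ) (S : Fin l → Bool) (v : Bool)
    (h : ¬∀ i : Fin l, (i : ℕ) < n → S i = v) : ∃ i : Fin l, (i : ℕ) < n ∧ S i = !v := by
  push Not at h
  obtain ⟨i, hi, hS⟩ := h
  refine ⟨i, hi, ?_⟩
  revert hS
  cases S i <;> cases v <;> simp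

/-- THE SCREENING SUM: `Σ_{(C,R) ∉ {(∅,∅),(all,all)}} θ^{#(X(C,R) ∖ UR)} ≤ Σ*` (case analysis on the low
parts of `C` and `R`, see `sigmaStar`). -/
theorem sum_nontrivial_le (m k n : ℕ) (hnm : n ≤ m) (hnk : n ≤ k) (θ : ℝ) (hθ0 : 0 ≤ θ)
    (hθ1 : θ ≤ 1) :
    ∑ x ∈ ((univ : Finset ((Fin m → Bool) × (Fin k → Bool))).erase (fun _ => false, fun _ => false)).erase
        (fun _ => true, fun _ => true), θ ^ nOut n x.1 x.2 ≤ sigmaStar m k n θ := by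
  set bot : (Fin m → Bool) × (Fin k → Bool) := (fun _ => false, fun _ => false) with hbot
  set top : (Fin m → Bool) × (Fin k → Bool) := (fun _ => true, fun _ => true) with htop
  set s := ((univ : Finset ((Fin m → Bool) × (Fin k → Bool))).erase bot).erase top with hs
  set T := θ ^ n with hT
  have hT0 : 0 ≤ T := pow_nonneg hθ0 n
  -- the generating terms of cases (iii) (`v = false`) and (iv) (`v = true`)
  set I : Bool → (Fin m → Bool) × (Fin k → Bool) → ℝ := fun v x =>
    if (∀ c : Fin m, (c : ℕ) < n → x.1 c = v) ∧ (∀ r : Fin k, (r : ℕ) < n → x.2 r = v) then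
      T ^ (univ.filter fun c => x.1 c = !v).card * T ^ (univ.filter fun r => x.2 r = !v).card else 0 with hI
  have hI0 : ∀ v x, 0 ≤ I v x := fun v x => by
    simp only [hI]
    split_ifs
    · positivity
    · exact le_rfl
  have hIle : ∀ v x, (∀ c : Fin m, (c : ℕ) < n → x.1 c = v) → (∀ r : Fin k, (r : ℕ) < n → x.2 r = v) →
      θ ^ nOut n x.1 x.2 ≤ I v x := by
    intro v x hC hR
    simp only [hI, if_pos (And.intro hC hR), hT]
    rw [← pow_mul, ← pow_mul, ← pow_add]
    exact pow_le_pow_of_le_one hθ0 hθ1 (le_nOut_of_low_const n hnm hnk v x.1 x.2 hC hR)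
  have hθm : 0 ≤ θ ^ m := pow_nonneg hθ0 m
  have hθk : 0 ≤ θ ^ k := pow_nonneg hθ0 k
  have hθnn : 0 ≤ θ ^ (n * n) := pow_nonneg hθ0 (n * n)
  -- pointwise bound by the sum of the case bounds
  have hpt : ∀ x ∈ s, θ ^ nOut n x.1 x.2 ≤ θ ^ m + θ ^ k + θ ^ (n * n) + I false x + I true x := by
    intro x _
    have hIf := hI0 false x
    have hIt := hI0 true x
    by_cases hRt : ∀ r : Fin k, (r : ℕ) < n → x.2 r = true
    · by_cases hCt : ∀ c : Fin m, (c : ℕ) < n → x.1 c = true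
      · have := hIle true x hCt hRt
        linarith
      · by_cases hCf : ∀ c : Fin m, (c : ℕ) < n → x.1 c = false
        · have := pow_le_pow_of_le_one hθ0 hθ1 (le_nOut_of_low_mixed n hnm hnk false x.1 x.2 hCf hRt)
          linarith
        · obtain ⟨c₁, hc₁, hC₁⟩ := exists_low_eq_not n x.1 true hCt
          obtain ⟨c₀, hc₀, hC₀⟩ := exists_low_eq_not n x.1 false hCf
          have := pow_le_pow_of_le_one hθ0 hθ1 (le_nOut_of_cols_mixed n x.1 x.2 c₀ c₁ hc₀ hC₀ hc₁ hC₁)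
          linarith
    · by_cases hRf : ∀ r : Fin k, (r : ℕ) < n → x.2 r = false
      · by_cases hCf : ∀ c : Fin m, (c : ℕ) < n → x.1 c = false
        · have := hIle false x hCf hRf
          linarith
        · by_cases hCt : ∀ c : Fin m, (c : ℕ) < n → x.1 c = true
          · have := pow_le_pow_of_le_one hθ0 hθ1 (le_nOut_of_low_mixed n hnm hnk true x.1 x.2 hCt hRf)
            linarith
          · obtain ⟨c₁, hc₁, hC₁⟩ := exists_low_eq_not n x.1 true hCt
            obtain ⟨c₀, hc₀, hC₀⟩ := exists_low_eq_not n x.1 false hCf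
            have := pow_le_pow_of_le_one hθ0 hθ1 (le_nOut_of_cols_mixed n x.1 x.2 c₀ c₁ hc₀ hC₀ hc₁ hC₁)
            linarith
      · obtain ⟨r₁, hr₁, hR₁⟩ := exists_low_eq_not n x.2 true hRt
        obtain ⟨r₀, hr₀, hR₀⟩ := exists_low_eq_not n x.2 false hRf
        have := pow_le_pow_of_le_one hθ0 hθ1 (le_nOut_of_rows_mixed n x.1 x.2 r₀ r₁ hr₀ hR₀ hr₁ hR₁)
        linarith
  -- summing: the number of pairs
  have hcard : (s.card : ℝ) ≤ 2 ^ (m + k) := by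
    have h1 : s.card ≤ Fintype.card ((Fin m → Bool) × (Fin k → Bool)) := Finset.card_le_univ s
    have h2 : Fintype.card ((Fin m → Bool) × (Fin k → Bool)) = 2 ^ (m + k) := by
      simp [Fintype.card_prod, Fintype.card_bool, pow_add]
    exact_mod_cast h1.trans h2.le
  -- summing: the generating sums minus their trivial term
  have hIf : ∑ x ∈ s, I false x ≤ (1 + T) ^ (m + k - 2 * n) - 1 := by
    have hsub : s ⊆ (univ : Finset ((Fin m → Bool) × (Fin k → Bool))).erase bot := Finset.erase_subset _ _
    calc ∑ x ∈ s, I false x ≤ ∑ x ∈ univ.erase bot, I false x :=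
          Finset.sum_le_sum_of_subset_of_nonneg hsub fun x _ _ => hI0 false x
      _ = ∑ x, I false x - I false bot := Finset.sum_erase_eq_sub (Finset.mem_univ _)
      _ = (1 + T) ^ (m + k - 2 * n) - 1 := by
          rw [show ∑ x, I false x = (1 + T) ^ (m + k - 2 * n) from sum_pair_low_const_pow n hnm hnk false T]
          simp [hI, hbot]
  have hIt : ∑ x ∈ s, I true x ≤ (1 + T) ^ (m + k - 2 * n) - 1 := by
    have hsub : s ⊆ (univ : Finset ((Fin m → Bool) × (Fin k → Bool))).erase top := fun x hx =>
      Finset.mem_erase.mpr ⟨(Finset.mem_erase.mp hx).1, Finset.mem_univ _⟩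
    calc ∑ x ∈ s, I true x ≤ ∑ x ∈ univ.erase top, I true x :=
          Finset.sum_le_sum_of_subset_of_nonneg hsub fun x _ _ => hI0 true x
      _ = ∑ x, I true x - I true top := Finset.sum_erase_eq_sub (Finset.mem_univ _)
      _ = (1 + T) ^ (m + k - 2 * n) - 1 := by
          rw [show ∑ x, I true x = (1 + T) ^ (m + k - 2 * n) from sum_pair_low_const_pow n hnm hnk true T]
          simp [hI, htop]
  calc ∑ x ∈ s, θ ^ nOut n x.1 x.2 ≤ ∑ x ∈ s, (θ ^ m + θ ^ k + θ ^ (n * n) + I false x + I true x) :=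
        Finset.sum_le_sum hpt
    _ = s.card * (θ ^ m + θ ^ k + θ ^ (n * n)) + ∑ x ∈ s, I false x + ∑ x ∈ s, I true x := by
        rw [Finset.sum_add_distrib, Finset.sum_add_distrib, Finset.sum_const, nsmul_eq_mul]
    _ ≤ 2 ^ (m + k) * (θ ^ m + θ ^ k + θ ^ (n * n)) +
          ((1 + T) ^ (m + k - 2 * n) - 1) + ((1 + T) ^ (m + k - 2 * n) - 1) := by
        have : (0 : ℝ) ≤ θ ^ m + θ ^ k + θ ^ (n * n) := by positivity
        nlinarith
    _ ≤ sigmaStar m k n θ := by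
        unfold sigmaStar
        rw [pow_succ]
        nlinarith [mul_nonneg (pow_nonneg (show (0 : ℝ) ≤ 2 by norm_num) (m + k)) hθnn]

/-- `χ_∅ = 1`. -/
theorem chiY_empty (q : Fin m × Fin k → Bool) : chiY ∅ q = 1 := Finset.prod_empty

/-- CONSISTENCY: if some array has parities `kk`, then `ε(all, all) = 1`
(`Σ_c kk.1 c ≡ #{true entries} ≡ Σ_r kk.2 r`). -/
theorem epsCR_top_eq_one (q : Fin m × Fin k → Bool) (kk : (Fin m → Bool) × (Fin k → Bool))
    (hq : parities q = kk) : epsCR kk (fun _ => true) (fun _ => true) = 1 := by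
  subst hq
  unfold epsCR parities
  simp only [if_true]
  have hc : ∀ c, sgnR (colPar q c) = ∏ r, sgnR (q (c, r)) := fun c => by
    rw [prod_sgnR]
    rfl
  have hr : ∀ r, sgnR (rowPar q r) = ∏ c, sgnR (q (c, r)) := fun r => by
    rw [prod_sgnR]
    rfl
  simp only [hc, hr]
  rw [← Fintype.prod_prod_type' fun (c : Fin m) (r : Fin k) => sgnR (q (c, r)),
    ← Fintype.prod_prod_type_right' fun (c : Fin m) (r : Fin k) => sgnR (q (c, r)), ← Finset.prod_mul_distrib]
  simp [sgnR_mul_self]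

/-- REGISTERED SUB-GOAL `screeningArray` — PARITY CONDITIONING IS SCREENED: for independent column-biased
bits with `|1 - 2 p_c| ≤ θ`, a `[0,1]`-valued statistic `F` reading only the upper-right region
`{c ≥ n} × {r ≥ n}` is almost uncorrelated with the event "all column and row parities take the prescribed
values `kk`", in RATIO form: `|E[F; par = kk] - E[F] P(par = kk)| ≤ 2 Σ* P(par = kk)`.
Proof: `1[par = kk] = 2^{-(m+k)} Σ_{C,R} (-1)^{⟨kk,(C,R)⟩} χ_{X(C,R)}`; `E[F χ_X] = E[F χ_{X ∩ UR}] · ∏_{f ∈ X ∖ UR} (1 - 2p_{f.1})`;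
the terms `(C,R) = (∅,∅), (all,all)` give `2 E[F]` (`X = ∅`), every other term is `≤ θ^{#(X ∖ UR)}` in absolute
value, and `Σ_{other} θ^{#(X∖UR)} ≤ Σ*`; the same expansion with `F = 1` gives `P(par = kk) = 2^{-(m+k)}(2 ± Σ*)`. [folklore] -/
theorem screeningArray :
    ∀ (m k n : ℕ), 1 ≤ n → n ≤ m → n ≤ k → ∀ (p : Fin m → ℝ) (θ : ℝ),
      (∀ c, 0 ≤ p c ∧ p c ≤ 1) → 0 ≤ θ → θ ≤ 1 → (∀ c, |1 - 2 * p c| ≤ θ) → sigmaStar m k n θ ≤ 1 →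
      ∀ (F : (Fin m × Fin k → Bool) → ℝ), (∀ q, 0 ≤ F q ∧ F q ≤ 1) →
      (∀ q q' : Fin m × Fin k → Bool,
        (∀ f : Fin m × Fin k, n ≤ (f.1 : ℕ) → n ≤ (f.2 : ℕ) → q f = q' f) → F q = F q') →
      ∀ (kk : (Fin m → Bool) × (Fin k → Bool)),
      |arrSum p (fun q => if parities q = kk then F q else 0) -
          arrSum p F * arrSum p (fun q => if parities q = kk then 1 else 0)| ≤
        2 * sigmaStar m k n θ * arrSum p (fun q => if parities q = kk then 1 else 0) := by
  intro m k n hn hnm hnk p θ hp hθ0 hθ1 hpθ hσ1 F hF01 hF kk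
  set σ := sigmaStar m k n θ with hσ
  have hσ0 : 0 ≤ σ := by
    have h1 : (1 : ℝ) ≤ (1 + θ ^ n) ^ (m + k - 2 * n) := one_le_pow₀ (by linarith [pow_nonneg hθ0 n])
    simp only [hσ, sigmaStar]
    positivity
  -- the inconsistent case: no array has parities `kk`
  by_cases hcons : ∃ q₀ : Fin m × Fin k → Bool, parities q₀ = kk
  swap
  · have h0 : ∀ H : (Fin m × Fin k → Bool) → ℝ, arrSum p (fun q => if parities q = kk then H q else 0) = 0 := by
      intro H
      unfold arrSum
      refine Finset.sum_eq_zero fun q _ => ?_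
      dsimp only
      rw [if_neg (fun h => hcons ⟨q, h⟩), mul_zero]
    rw [h0 F, h0 (fun _ => 1)]
    simp
  obtain ⟨q₀, hq₀⟩ := hcons
  -- the pairs `(C, R)` and the two trivial ones
  set bot : (Fin m → Bool) × (Fin k → Bool) := (fun _ => false, fun _ => false) with hbot
  set top : (Fin m → Bool) × (Fin k → Bool) := (fun _ => true, fun _ => true) with htop
  set s := ((univ : Finset ((Fin m → Bool) × (Fin k → Bool))).erase bot).erase top with hs
  have htb : top ≠ bot := fun h => by
    have := congrFun (congrArg Prod.fst h) ⟨0, by omega⟩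
    simp [htop, hbot] at this
  -- expansion of `E[H; kk]` with the two trivial terms separated
  have hexp : ∀ H : (Fin m × Fin k → Bool) → ℝ,
      arrSum p (fun q => if parities q = kk then H q else 0) =
        (2 * arrSum p H + ∑ x ∈ s, epsCR kk x.1 x.2 * arrSum p (fun q => chiY (xSet x.1 x.2) q * H q)) /
          2 ^ (m + k) := by
    intro H
    rw [arrSum_indicator_expand]
    congr 1
    rw [show (∑ C : Fin m → Bool, ∑ R : Fin k → Bool,
        epsCR kk C R * arrSum p (fun q => chiY (xSet C R) q * H q)) =
        ∑ x : (Fin m → Bool) × (Fin k → Bool),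
          epsCR kk x.1 x.2 * arrSum p (fun q => chiY (xSet x.1 x.2) q * H q) from
      (Fintype.sum_prod_type' fun (C : Fin m → Bool) (R : Fin k → Bool) =>
        epsCR kk C R * arrSum p (fun q => chiY (xSet C R) q * H q)).symm]
    rw [← Finset.add_sum_erase _ _ (Finset.mem_univ bot),
      ← Finset.add_sum_erase _ _ (Finset.mem_erase.mpr ⟨htb, Finset.mem_univ top⟩)]
    have hxb : xSet bot.1 bot.2 = ∅ := by ext f; simp [hbot, xSet]
    have hxt : xSet top.1 top.2 = ∅ := by ext f; simp [htop, xSet]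
    have heb : epsCR kk bot.1 bot.2 = 1 := by simp [hbot, epsCR]
    have het : epsCR kk top.1 top.2 = 1 := epsCR_top_eq_one q₀ kk hq₀
    simp only [hxb, hxt, heb, het, chiY_empty, one_mul]
    ring
  -- the nontrivial terms are bounded by `Σ*`
  have hbound : ∀ H : (Fin m × Fin k → Bool) → ℝ, (∀ q, 0 ≤ H q ∧ H q ≤ 1) →
      (∀ q q' : Fin m × Fin k → Bool,
        (∀ f : Fin m × Fin k, n ≤ (f.1 : ℕ) → n ≤ (f.2 : ℕ) → q f = q' f) → H q = H q') →
      |∑ x ∈ s, epsCR kk x.1 x.2 * arrSum p (fun q => chiY (xSet x.1 x.2) q * H q)| ≤ σ := by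
    intro H hH01 hH
    calc |∑ x ∈ s, epsCR kk x.1 x.2 * arrSum p (fun q => chiY (xSet x.1 x.2) q * H q)|
        ≤ ∑ x ∈ s, |epsCR kk x.1 x.2 * arrSum p (fun q => chiY (xSet x.1 x.2) q * H q)| :=
          Finset.abs_sum_le_sum_abs _ _
      _ ≤ ∑ x ∈ s, θ ^ nOut n x.1 x.2 := Finset.sum_le_sum fun x _ => by
          rw [abs_mul, abs_epsCR, one_mul]
          exact abs_arrSum_chiY_mul_le p hp θ hθ0 hθ1 hpθ n H hH01 hH _
      _ ≤ σ := sum_nontrivial_le m k n hnm hnk θ hθ0 hθ1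
  set e1 := ∑ x ∈ s, epsCR kk x.1 x.2 * arrSum p (fun q => chiY (xSet x.1 x.2) q * F q) with he1
  set e2 := ∑ x ∈ s, epsCR kk x.1 x.2 * arrSum p (fun q => chiY (xSet x.1 x.2) q * (fun _ => (1 : ℝ)) q)
    with he2
  have hb1 := hbound F hF01 hF
  have hb2 := hbound (fun _ => (1 : ℝ)) (fun _ => by norm_num) (fun _ _ _ => rfl)
  rw [← he1] at hb1
  rw [← he2] at hb2
  have hEF : arrSum p (fun q => if parities q = kk then F q else 0) = (2 * arrSum p F + e1) / 2 ^ (m + k) :=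
    hexp F
  have hW : arrSum p (fun q => if parities q = kk then (1 : ℝ) else 0) = (2 + e2) / 2 ^ (m + k) := by
    have h := hexp (fun _ => (1 : ℝ))
    have h1 : arrSum p (fun _ : Fin m × Fin k → Bool => (1 : ℝ)) = 1 := by
      unfold arrSum
      simp only [mul_one]
      exact sum_arrWeight p
    rw [h1, mul_one] at h
    exact h
  have hEF01 : 0 ≤ arrSum p F ∧ arrSum p F ≤ 1 := by
    constructor
    · exact Finset.sum_nonneg fun q _ => mul_nonneg (arrWeight_nonneg p hp q) (hF01 q).1
    · have := abs_arrSum_le_one p hp F fun q => by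
        rw [abs_of_nonneg (hF01 q).1]
        exact (hF01 q).2
      exact (abs_le.mp this).2
  have hD : (0 : ℝ) < 2 ^ (m + k) := by positivity
  rw [hEF, hW]
  rw [abs_le] at hb1 hb2
  have hlhs : (2 * arrSum p F + e1) / 2 ^ (m + k) - arrSum p F * ((2 + e2) / 2 ^ (m + k)) =
      (e1 - arrSum p F * e2) / 2 ^ (m + k) := by
    field_simp
    ring
  rw [hlhs, abs_div, abs_of_pos hD, div_le_iff₀ hD,
    show 2 * σ * ((2 + e2) / 2 ^ (m + k)) * 2 ^ (m + k) = 2 * σ * (2 + e2) by field_simp]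
  calc |e1 - arrSum p F * e2| ≤ |e1| + |arrSum p F * e2| := abs_sub _ _
    _ ≤ σ + σ := by
        rw [abs_mul, abs_of_nonneg hEF01.1]
        have h1 : |e1| ≤ σ := abs_le.mpr hb1
        have h2 : |e2| ≤ σ := abs_le.mpr hb2
        nlinarith [abs_nonneg e2, hEF01.1, hEF01.2]
    _ ≤ 2 * σ * (2 + e2) := by nlinarith

end Summit.CriticalPhenomena.CardyFormulaZ2.Theorems.IKLinearTransport.PinnedDiagramExchange.ScreeningArray
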